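import Summits.BirchSwinnertonDyer.BirchSwinnertonDyer.Theorems.ResidualThetaTransportAtTwoPlusDualLayerToolkit
import HarnessLib

/-!
# Kim 2007 Prop. 3.15 — LAYER NORMS of a cofree rank-one dual pair: `#S[p^J, ω_m] = p^{J p^m}`, Kim's cor-surjectivity
# `ν_{m/n}·S[p^J, ω_m] = S[p^J, ω_n]`, the twisted «invariants = norms», and monic divisors of distinguished polynomials

Routes `ResidualThetaTransportAtTwo` (RTT, crux r201 `ResidualLambdaFormulaNegDiscAtTwo`, stmt-BirchSwinnertonDyer-23110) /
`ThetaPartnerAtTwo`. Seat `prover-bsd-wall-tp2-p2x-w3` g13; `--supports stmt-BirchSwinnertonDyer-23110`. THEOREMS ONLY (no definition,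
no named fact, no instance, no `sorry`); PURE ALGEBRA; closes nothing. Sequel of `…PlusDualLayerAlgebra` (abstract cofree calculus),
instantiated at the elements of `Λ = ℤ_p⟦T⟧` occurring in B. D. Kim, Compositio Math. 143 (2007), proof of Prop. 3.15 (pp. 56–57),
for a dual pair `IsDualPair p (φ − 1) toDual` with `X ≃ₗ[Λ] Λ` ((R1)@2 of road T, `PlusDual.nonempty_linearEquiv_iwasawaAlgebra_two`):
* (toolkit `…PlusDualLayerToolkit`: transposes of integer polynomials; monic divisors of distinguished polynomials are distinguished)
* layers: **`#{s : p^J s = 0, φ^{p^m} s = s} = p^{J·p^m}`** (Kim: «`H_n[p^j] ≅ (ℤ/p^j)^{dpⁿ}`»); **COR-SURJECTIVITY**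
  `(∑_{i<p^{m−n}} φ^{pⁿi}) '' S[p^J, φ^{p^m}=1] = S[p^J, φ^{pⁿ}=1]` (`norm_image_torsionBy_eq`, Kim (d) «`Cor^m_n(H_m[p^j]) = H_n[p^j]`»);
  **TWISTED «INVARIANTS = NORMS»** `(∑_{i<p^m} (cφ)ⁱ) '' S[p^J, φ^{p^m}=1] = {s : p^J s = 0, c·φ s = s}` for `c ≡ 1 (p)`,
  `c^{p^m} ≡ 1 (p^J)` (`twistedNorm_image_torsionBy_eq`) — the algebra of the level-`0`/level-`m` twisted descent of ISO.

HONEST FRAMING: closes nothing; ISO / `hdual_Alt` are NOT proved here; 23110 is NOT proved; BSD is not proved by any of this.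
References: [BDKim2007] Prop. 3.15 (proof, pp. 56–57), Prop. 3.17; [Washington1997] §7.1, §13.2; [Lang1990] Ch. 5 §1;
[GreenbergLNM1716] §1 p. 60, §3 pp. 85–86.
-/

set_option autoImplicit false
-- D-0017: single-problem summit, so `Summit.BirchSwinnertonDyer.BirchSwinnertonDyer.…` repeats a namespace BY DESIGN.
set_option linter.dupNamespace false

noncomputable section

open scoped Classical
open Polynomial Literature.NumberTheory.EllipticCurves Literature.NumberTheory.EllipticCurves.IwasawaDual

namespace Summit.BirchSwinnertonDyer.BirchSwinnertonDyer.Theorems.ResidualThetaLayer.PlusDual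

/-! ## Layers of a cofree rank-one dual pair: `S[p^J, ω_m]`, Kim's cor-surjectivity, twisted norms -/

section Layers

variable {p : ℕ} [Fact p.Prime]
variable {S : Type*} [AddCommGroup S] {φ : AddMonoid.End S}
variable {X : Type*} [AddCommGroup X] [Module (PowerSeries ℤ_[p]) X]
variable {toDual : X →+ (S →+ AddCircle (1 : ℚ))}

omit [Fact p.Prime] in
/-- Evaluation of a finite sum of endomorphisms (bookkeeping). [folklore] -/
theorem end_finset_sum_apply {ι : Type*} (f : ι → AddMonoid.End S) (t : Finset ι) (s : S) :
    (∑ i ∈ t, f i) s = ∑ i ∈ t, f i s :=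
  AddMonoidHom.finsetSum_apply f t s

/-- **`ω_m` acts as `φ^{p^m} − 1`** through `toDual` (for `T ↦ φ − 1`). [cite: GreenbergLNM1716, §1 p. 62 (`θ_n = (1+T)^{pⁿ} − 1`)] -/
theorem transpose_omega (h : IsDualPair p (φ - 1) toDual) (m : ℕ) (x : X) (s : S) :
    toDual ((((Polynomial.X + 1 : ℤ_[p][X]) ^ p ^ m - 1 : ℤ_[p][X]) : PowerSeries ℤ_[p]) • x) s =
      toDual x (((φ ^ p ^ m - 1 : AddMonoid.End S) : S →+ S) s) := by
  rw [UniversalToricDescentTorsionFreeByCount.coe_omega p, sub_smul, one_smul, map_sub, AddMonoidHom.sub_apply,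
    h.toDual_one_add_X_pow_smul, ← map_sub]
  rfl

/-- **Goal-directed form of the cofree calculus** (`image_torsionBy_ker_comp_eq` with the two sets supplied by membership
criteria, so that instances such as `φ^{p^m} s = s` need no syntactic matching). [cite: BDKim2007, Prop. 3.15 (proof)] -/
theorem image_eq_of_mem_iff (h : IsDualPair p (φ - 1) toDual) (e : X ≃ₗ[PowerSeries ℤ_[p]] PowerSeries ℤ_[p])
    {Df Dg : ℤ_[p][X]} (hDf : Df.IsDistinguishedAt (IsLocalRing.maximalIdeal ℤ_[p]))
    (hDg : Dg.IsDistinguishedAt (IsLocalRing.maximalIdeal ℤ_[p])) {f g : PowerSeries ℤ_[p]}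
    (hf : Ideal.span {f} = Ideal.span {(Df : PowerSeries ℤ_[p])}) (hg : Ideal.span {g} = Ideal.span {(Dg : PowerSeries ℤ_[p])})
    {Ψf Ψg : S →+ S} (hΨf : ∀ (x : X) (s : S), toDual (f • x) s = toDual x (Ψf s))
    (hΨg : ∀ (x : X) (s : S), toDual (g • x) s = toDual x (Ψg s)) (J : ℕ) {A B : Set S}
    (hA : ∀ s, s ∈ A ↔ p ^ J • s = 0 ∧ Ψg (Ψf s) = 0) (hB : ∀ s, s ∈ B ↔ p ^ J • s = 0 ∧ Ψg s = 0) :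
    Ψf '' A = B := by
  have hA' : A = {s | p ^ J • s = 0 ∧ Ψg (Ψf s) = 0} := Set.ext fun s ↦ hA s
  have hB' : B = {s | p ^ J • s = 0 ∧ Ψg s = 0} := Set.ext fun s ↦ hB s
  rw [hA', hB']
  exact image_torsionBy_ker_comp_eq h e hDf hDg hf hg hΨf hΨg J

/-- **`#{s : p^J s = 0, φ^{p^m} s = s} = p^{J·p^m}`** for a dual pair of `(S, φ − 1)` with `X ≃ₗ[Λ] Λ`: the finite layer
`S[p^J, ω_m] ≅ Hom(Λ/(p^J, ω_m), ℚ/ℤ) = Hom((ℤ/p^J)[Γ/Γ_m], ℚ/ℤ)`. Kim: «an explicit computation shows that `H_n[p^j] ≅ (ℤ/p^jℤ)^{dpⁿ}`»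
(`d = 1`). [cite: BDKim2007, Prop. 3.15 (proof)] [cite: Washington1997, §13.2 (Prop. 13.8)] -/
theorem natCard_torsionBy_pow_fixed_eq_pow (h : IsDualPair p (φ - 1) toDual)
    (e : X ≃ₗ[PowerSeries ℤ_[p]] PowerSeries ℤ_[p]) (J m : ℕ) :
    Nat.card {s : S // p ^ J • s = 0 ∧ (φ ^ p ^ m) s = s} = p ^ (J * p ^ m) := by
  have hcount := natCard_torsionBy_ker_eq_pow h e (Kato2004.IwasawaH1Exists.isDistinguishedAt_omega p m) rfl
    ((φ ^ p ^ m - 1 : AddMonoid.End S) : S →+ S) (transpose_omega h m) J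
  rw [UniversalToricDescentTorsionFreeByCount.natDegree_omega p] at hcount
  rw [← hcount]
  refine Nat.card_congr (Equiv.subtypeEquivRight fun s ↦ ?_)
  show _ ↔ p ^ J • s = 0 ∧ (φ ^ p ^ m) s - s = 0
  rw [sub_eq_zero]

/-- The layer `S[p^J, ω_m]` is finite. [cite: BDKim2007, Prop. 3.15 (proof)] -/
theorem finite_torsionBy_pow_fixed (h : IsDualPair p (φ - 1) toDual)
    (e : X ≃ₗ[PowerSeries ℤ_[p]] PowerSeries ℤ_[p]) (J m : ℕ) :
    {s : S | p ^ J • s = 0 ∧ (φ ^ p ^ m) s = s}.Finite := by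
  have hne : Nat.card {s : S // p ^ J • s = 0 ∧ (φ ^ p ^ m) s = s} ≠ 0 := by
    rw [natCard_torsionBy_pow_fixed_eq_pow h e J m]
    exact pow_ne_zero _ (Fact.out : p.Prime).ne_zero
  exact Set.finite_coe_iff.mp (Nat.finite_of_card_ne_zero hne)

/-- **KIM'S COR-SURJECTIVITY `Cor^m_n(H_m[p^j]) = H_n[p^j]`, algebraic form.** For a dual pair of `(S, φ − 1)` with `X ≃ₗ[Λ] Λ` and
`n ≤ m`, the norm `ν_{m/n}(φ) = ∑_{i<p^{m−n}} φ^{pⁿ i}` maps the layer `S[p^J, φ^{p^m} = 1]` ONTO the layer `S[p^J, φ^{pⁿ} = 1]`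
(Kim: the transpose `h : Λ_n → Λ_m`, `x ↦ ∏_{n<k≤m} Φ_k(1+T)·x̃`, has `ℤ_p`-free cokernel, so `h*` is onto; here: `ν_{m/n}` is a
distinguished divisor of `ω_m` and the cofree calculus `image_torsionBy_ker_comp_eq` counts both sides).
[cite: BDKim2007, Prop. 3.15 (proof, pp. 56–57: «It implies `Cor^m_n(H^-_m[p^j]) = H^-_n[p^j]`»)] -/
theorem norm_image_torsionBy_eq (h : IsDualPair p (φ - 1) toDual) (e : X ≃ₗ[PowerSeries ℤ_[p]] PowerSeries ℤ_[p])
    {n m : ℕ} (hnm : n ≤ m) (J : ℕ) :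
    (⇑(∑ i ∈ Finset.range (p ^ (m - n)), (φ ^ p ^ n) ^ i : AddMonoid.End S)) ''
        {s : S | p ^ J • s = 0 ∧ (φ ^ p ^ m) s = s} = {s : S | p ^ J • s = 0 ∧ (φ ^ p ^ n) s = s} := by
  obtain ⟨hν, -⟩ := isDistinguishedAt_geom_sum (p := p) hnm
  have hωn := Kato2004.IwasawaH1Exists.isDistinguishedAt_omega p n
  set N : AddMonoid.End S := ∑ i ∈ Finset.range (p ^ (m - n)), (φ ^ p ^ n) ^ i with hN
  -- the transpose of `ν_{m/n}` is `N`
  have hcoeν : ((∑ i ∈ Finset.range (p ^ (m - n)), ((Polynomial.X + 1 : ℤ_[p][X]) ^ p ^ n) ^ i : ℤ_[p][X]) :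
      PowerSeries ℤ_[p]) = ∑ i ∈ Finset.range (p ^ (m - n)), ((1 + PowerSeries.X : PowerSeries ℤ_[p]) ^ p ^ n) ^ i := by
    rw [← Polynomial.coeToPowerSeries.ringHom_apply, map_sum]
    simp only [Polynomial.coeToPowerSeries.ringHom_apply, Polynomial.coe_pow, Polynomial.coe_add, Polynomial.coe_X,
      Polynomial.coe_one, add_comm]
  have hΨf : ∀ (x : X) (s : S), toDual (((∑ i ∈ Finset.range (p ^ (m - n)),
      ((Polynomial.X + 1 : ℤ_[p][X]) ^ p ^ n) ^ i : ℤ_[p][X]) : PowerSeries ℤ_[p]) • x) s = toDual x ((N : S →+ S) s) := by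
    intro x s
    rw [hcoeν, Finset.sum_smul, map_sum toDual, AddMonoidHom.finsetSum_apply, hN, end_finset_sum_apply, map_sum (toDual x)]
    refine Finset.sum_congr rfl fun i _ ↦ ?_
    rw [← pow_mul, h.toDual_one_add_X_pow_smul, pow_mul]
  -- `(φ^{pⁿ} − 1) ∘ N = φ^{p^m} − 1`
  have hcomp : ∀ s : S, ((φ ^ p ^ n - 1) * N) s = (φ ^ p ^ m) s - s := by
    intro s
    rw [hN, mul_geom_sum, ← pow_mul, ← pow_add, Nat.add_sub_cancel' hnm]
    rfl
  refine image_eq_of_mem_iff h e hν hωn rfl rfl hΨf (transpose_omega h n) J (fun s ↦ ?_) (fun s ↦ ?_)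
  · rw [Set.mem_setOf_eq]
    constructor
    · rintro ⟨h1, h2⟩
      refine ⟨h1, ?_⟩
      show ((φ ^ p ^ n - 1) * N) s = 0
      rw [hcomp, sub_eq_zero]; exact h2
    · rintro ⟨h1, h2⟩
      refine ⟨h1, ?_⟩
      have h2' : ((φ ^ p ^ n - 1) * N) s = 0 := h2
      rw [hcomp, sub_eq_zero] at h2'; exact h2'
  · rw [Set.mem_setOf_eq]
    constructor
    · rintro ⟨h1, h2⟩
      refine ⟨h1, ?_⟩
      show (φ ^ p ^ n) s - s = 0
      rw [sub_eq_zero]; exact h2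
    · rintro ⟨h1, h2⟩
      refine ⟨h1, ?_⟩
      have h2' : (φ ^ p ^ n) s - s = 0 := h2
      rw [sub_eq_zero] at h2'; exact h2'

/-- Powers of a transposed pair are transposed: `q ↦ Θ` gives `q^i ↦ Θ^i` (`Θ ∈ End(S)`). [folklore] -/
theorem transpose_pow {q : PowerSeries ℤ_[p]} {Θ : AddMonoid.End S}
    (hq : ∀ (x : X) (s : S), toDual (q • x) s = toDual x (Θ s)) (i : ℕ) (x : X) (s : S) :
    toDual ((q ^ i) • x) s = toDual x ((Θ ^ i) s) := by
  induction i generalizing x with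
  | zero => rw [pow_zero, one_smul, pow_zero, AddMonoid.End.one_apply]
  | succ i ih => rw [pow_succ, mul_smul, ih, hq, pow_succ']; rfl

/-- **TWISTED «INVARIANTS = NORMS» on the layer `S[p^J, ω_m]`.** For a dual pair of `(S, φ − 1)` with `X ≃ₗ[Λ] Λ`, an integer
`c ≡ 1 (mod p)` with `c^{p^m} ≡ 1 (mod p^J)`: the twisted norm `N_c = ∑_{i<p^m} (c·φ)ⁱ` maps `{s : p^J s = 0, φ^{p^m} s = s}` ONTO the
twisted invariants `{s : p^J s = 0, c·φ s = s}` (`Ĥ⁰ = 0` for the induced module `Hom((ℤ/p^J)[C_{p^m}], ℚ/ℤ) ⊗ χ_c`; here by the cofree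
calculus with the distinguished generators `T − (c⁻¹ − 1) ~ c(1+T) − 1` and `((1+T)^{p^m} − c^{−p^m})/(T − (c⁻¹ − 1)) ~ N_c(1+T)`).
[cite: BDKim2007, Prop. 3.15 (proof, pp. 56–57)] [cite: GreenbergLNM1716, §3 pp. 85–86 (twisting by `κ^s`)] -/
theorem twistedNorm_image_torsionBy_eq (h : IsDualPair p (φ - 1) toDual) (e : X ≃ₗ[PowerSeries ℤ_[p]] PowerSeries ℤ_[p])
    {c : ℤ} (hc : (p : ℤ) ∣ c - 1) (m J : ℕ) (hcJ : ((p : ℤ) ^ J) ∣ c ^ p ^ m - 1) :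
    (⇑(∑ i ∈ Finset.range (p ^ m), ((c : AddMonoid.End S) * φ) ^ i : AddMonoid.End S)) ''
        {s : S | p ^ J • s = 0 ∧ (φ ^ p ^ m) s = s} = {s : S | p ^ J • s = 0 ∧ c • φ s = s} := by
  have hp : p.Prime := Fact.out
  set 𝔪 := IsLocalRing.maximalIdeal ℤ_[p] with h𝔪
  obtain ⟨u, hu⟩ := isUnit_intCast_of_dvd_sub_one (p := p) hc
  -- `c − 1 ∈ 𝔪`, `u⁻¹ − 1 ∈ 𝔪`, `u^{-p^m} − 1 ∈ 𝔪`
  have hc1 : ((c : ℤ_[p]) - 1) ∈ 𝔪 := by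
    rw [h𝔪, PadicInt.maximalIdeal_eq_span_p, Ideal.mem_span_singleton]
    obtain ⟨k, hk⟩ := hc
    exact ⟨(k : ℤ_[p]), by exact_mod_cast hk⟩
  have hui : ((↑u⁻¹ : ℤ_[p]) - 1) ∈ 𝔪 := by
    have e1 : ((↑u⁻¹ : ℤ_[p]) - 1) = -(↑u⁻¹ * ((c : ℤ_[p]) - 1)) := by
      rw [mul_sub, ← hu, Units.inv_mul, mul_one]; ring
    rw [e1]; exact neg_mem (Ideal.mul_mem_left _ _ hc1)
  have hbm : (1 - (↑u⁻¹ : ℤ_[p]) ^ p ^ m) ∈ 𝔪 := by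
    have hq1 : Ideal.Quotient.mk 𝔪 (↑u⁻¹ : ℤ_[p]) = 1 := by
      rw [← (Ideal.Quotient.mk 𝔪).map_one, Ideal.Quotient.eq]; exact hui
    rw [← Ideal.Quotient.eq, map_one, map_pow, hq1, one_pow]
  -- the polynomials `F = ∑ (c(T+1))ⁱ`, `G = c(T+1) − 1`, `H = (c(T+1))^{p^m} − 1`, `F·G = H`
  set y : ℤ_[p][X] := C (c : ℤ_[p]) * (Polynomial.X + 1) with hy
  set F : ℤ_[p][X] := ∑ i ∈ Finset.range (p ^ m), y ^ i with hF
  set G : ℤ_[p][X] := y - 1 with hG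
  have hFG : F * G = y ^ p ^ m - 1 := by rw [hF, hG, geom_sum_mul]
  -- distinguished normalisations `D_g = u⁻¹ G = T − (u⁻¹ − 1)·(−1)…`, `D_h = u^{-p^m} H`, `D_f = u^{-(p^m−1)} F`
  set Dg : ℤ_[p][X] := Polynomial.X - C (↑u⁻¹ - 1 : ℤ_[p]) with hDg0
  have hDg : Dg = C (↑u⁻¹ : ℤ_[p]) * G := by
    rw [hDg0, hG, hy, mul_sub, ← mul_assoc, ← C_mul, ← hu, Units.inv_mul, C_1, one_mul, mul_one, map_sub, map_one]
    ring
  have hDg_dist : Dg.IsDistinguishedAt 𝔪 := IwasawaAlgebra.isDistinguishedAt_X_sub_C p hui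
  set Dh : ℤ_[p][X] := ((Polynomial.X + 1) ^ p ^ m - 1) + C (1 - (↑u⁻¹ : ℤ_[p]) ^ p ^ m) with hDh0
  have hDh : Dh = C ((↑u⁻¹ : ℤ_[p]) ^ p ^ m) * (y ^ p ^ m - 1) := by
    rw [hDh0, hy, mul_sub, mul_pow, ← mul_assoc, ← C_pow, ← C_mul, ← mul_pow, ← hu, Units.inv_mul, one_pow, C_1,
      one_mul, map_sub, map_one]
    ring
  have hDh_dist : Dh.IsDistinguishedAt 𝔪 :=
    isDistinguishedAt_add_C (Kato2004.IwasawaH1Exists.isDistinguishedAt_omega p m)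
      (by rw [UniversalToricDescentTorsionFreeByCount.natDegree_omega p]; exact pow_pos hp.pos m) hbm
  have hpm : p ^ m - 1 + 1 = p ^ m := Nat.sub_add_cancel (Nat.one_le_pow _ _ hp.pos)
  set Df : ℤ_[p][X] := C ((↑u⁻¹ : ℤ_[p]) ^ (p ^ m - 1)) * F with hDf0
  have hDfDg : Df * Dg = Dh := by
    rw [hDf0, hDg, hDh, mul_mul_mul_comm, ← C_mul, ← pow_succ, hpm, hFG]
  have hDg_monic : Dg.Monic := hDg_dist.monic
  have hDf_monic : Df.Monic := Monic.of_mul_monic_right hDg_monic (by rw [hDfDg]; exact hDh_dist.monic)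
  have hDf_dist : Df.IsDistinguishedAt 𝔪 := isDistinguishedAt_of_mul_eq hDh_dist hDf_monic hDg_monic hDfDg
  -- the `Λ`-elements and their transposes
  set θ : AddMonoid.End S := (c : AddMonoid.End S) * φ with hθ
  have hθs : ∀ s : S, θ s = c • φ s := fun s ↦ by rw [hθ]; exact AddMonoid.End.intCast_apply c (φ s)
  have hcoey : ((y : ℤ_[p][X]) : PowerSeries ℤ_[p]) = (c : PowerSeries ℤ_[p]) * (1 + PowerSeries.X) := by
    rw [hy, Polynomial.coe_mul, Polynomial.coe_C, Polynomial.coe_add, Polynomial.coe_X, Polynomial.coe_one, map_intCast,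
      add_comm]
  have hty : ∀ (x : X) (s : S), toDual (((y : ℤ_[p][X]) : PowerSeries ℤ_[p]) • x) s = toDual x (θ s) := by
    intro x s
    rw [hcoey, mul_smul, toDual_intCast_smul, h.toDual_one_add_X_smul, map_zsmul, hθs]
  have htF : ∀ (x : X) (s : S), toDual (((F : ℤ_[p][X]) : PowerSeries ℤ_[p]) • x) s =
      toDual x ((∑ i ∈ Finset.range (p ^ m), θ ^ i : AddMonoid.End S) s) := by
    intro x s
    rw [hF, ← Polynomial.coeToPowerSeries.ringHom_apply, map_sum, Finset.sum_smul, map_sum toDual,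
      AddMonoidHom.finsetSum_apply, end_finset_sum_apply, map_sum (toDual x)]
    refine Finset.sum_congr rfl fun i _ ↦ ?_
    rw [map_pow, Polynomial.coeToPowerSeries.ringHom_apply, transpose_pow hty]
  have htG : ∀ (x : X) (s : S), toDual (((G : ℤ_[p][X]) : PowerSeries ℤ_[p]) • x) s =
      toDual x (((θ - 1 : AddMonoid.End S) : S →+ S) s) := by
    intro x s
    rw [hG, Polynomial.coe_sub, Polynomial.coe_one, sub_smul, one_smul, map_sub, AddMonoidHom.sub_apply, hty, ← map_sub]
    rfl
  -- generators: `span{↑F} = span{↑Df}`, `span{↑G} = span{↑Dg}` (unit multiples)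
  have hunitC : ∀ k : ℕ, IsUnit (PowerSeries.C ((↑u⁻¹ : ℤ_[p]) ^ k) : PowerSeries ℤ_[p]) := fun k ↦
    ((u⁻¹).isUnit.pow k).map _
  have hspanF : Ideal.span {((F : ℤ_[p][X]) : PowerSeries ℤ_[p])} = Ideal.span {((Df : ℤ_[p][X]) : PowerSeries ℤ_[p])} := by
    rw [hDf0, Polynomial.coe_mul, Polynomial.coe_C, Ideal.span_singleton_mul_left_unit (hunitC _)]
  have hspanG : Ideal.span {((G : ℤ_[p][X]) : PowerSeries ℤ_[p])} = Ideal.span {((Dg : ℤ_[p][X]) : PowerSeries ℤ_[p])} := by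
    rw [hDg, Polynomial.coe_mul, Polynomial.coe_C, ← pow_one (↑u⁻¹ : ℤ_[p]), Ideal.span_singleton_mul_left_unit (hunitC 1)]
  -- `(θ − 1) ∘ N_c = θ^{p^m} − 1 = c^{p^m} φ^{p^m} − 1`, which is `φ^{p^m} − 1` on `S[p^J]`
  have hcomp : ∀ s : S, ((θ - 1) * ∑ i ∈ Finset.range (p ^ m), θ ^ i) s = (c ^ p ^ m) • (φ ^ p ^ m) s - s := by
    intro s
    rw [mul_geom_sum, hθ, (Int.cast_commute c φ).mul_pow, ← Int.cast_pow]
    exact congrArg (· - s) (AddMonoid.End.intCast_apply _ _)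
  have hkey : ∀ s : S, p ^ J • s = 0 → ((c ^ p ^ m) • (φ ^ p ^ m) s - s = 0 ↔ (φ ^ p ^ m) s = s) := by
    intro s hs
    obtain ⟨k, hk⟩ := hcJ
    have e1 : (c ^ p ^ m) • (φ ^ p ^ m) s = (φ ^ p ^ m) s + k • ((p ^ J : ℕ) : ℤ) • (φ ^ p ^ m) s := by
      rw [Nat.cast_pow, ← mul_zsmul, mul_comm, ← hk, sub_zsmul, one_zsmul]
      abel
    rw [e1, natCast_zsmul, ← map_nsmul, hs, map_zero, zsmul_zero, add_zero, sub_eq_zero]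
  refine image_eq_of_mem_iff h e hDf_dist hDg_dist hspanF hspanG htF htG J (fun s ↦ ?_) (fun s ↦ ?_)
  · rw [Set.mem_setOf_eq]
    constructor
    · rintro ⟨h1, h2⟩
      refine ⟨h1, ?_⟩
      show ((θ - 1) * ∑ i ∈ Finset.range (p ^ m), θ ^ i) s = 0
      rw [hcomp, hkey s h1]; exact h2
    · rintro ⟨h1, h2⟩
      refine ⟨h1, ?_⟩
      have h2' : ((θ - 1) * ∑ i ∈ Finset.range (p ^ m), θ ^ i) s = 0 := h2
      rw [hcomp, hkey s h1] at h2'; exact h2'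
  · rw [Set.mem_setOf_eq]
    constructor
    · rintro ⟨h1, h2⟩
      refine ⟨h1, ?_⟩
      show θ s - s = 0
      rw [hθs, sub_eq_zero]; exact h2
    · rintro ⟨h1, h2⟩
      refine ⟨h1, ?_⟩
      have h2' : θ s - s = 0 := h2
      rw [hθs, sub_eq_zero] at h2'; exact h2'

end Layers

end Summit.BirchSwinnertonDyer.BirchSwinnertonDyer.Theorems.ResidualThetaLayer.PlusDual

end
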